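import Literature.Geometry.Kaehler.ComplexTorusHilbertModularCuspStabilizerTranslationAverageInvariance
import Literature.Geometry.Kaehler.ComplexTorusHilbertModularCuspStabilizerDilationInvariance
import HarnessLib

/-!
# Freitag's frame `dx_σ, dy_σ/y_σ` as a pointwise basis of forms on `ℍⁿ`: coefficients, expansion, and their
# transformation under `Γ_∞` and under dilations (Freitag, *Hilbert Modular Forms*, Ch. III §2, pp. 143–145)

Geometry/Kaehler ∕ NumberTheory/Automorphic support file, sequel of `…CuspStabilizerForms` (the closed invariant forms
`coordForm c = c_1 ∧ ⋯ ∧ c_k`, `c_j ∈ {dx_σ, dy_σ/y_σ}`) and of `…CuspStabilizerTranslationAverageInvariance` (every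
class of `H^•((ℍⁿ, Γ_∞))` has an `x`-independent representative). Everything proved; definitions with bodies, no
named fact.

Freitag's proof of Prop. III.2.1 (generation half, p. 145) writes an invariant form in the frame
`ω = Σ_{a,b} f_{ab}(z) dx_a ∧ dy_b/y_b` and argues on the coefficient functions `f_{ab}`. This file sets up that frame
as honest linear algebra at each point `z ∈ ℍⁿ`:

* §1 the frame VECTORS `frameVec z (inl σ) = e_σ`, `frameVec z (inr σ) = y_σ · i e_σ`, DUAL to the coordinate
  functionals with their weights: `coordCLM s (frameVec z s') = δ_{s s'} · coordWeight z s` (`coordCLM_frameVec`); for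
  `z ∈ ℍⁿ` they form a real basis of `ℂ^{Hom(F,ℝ)}` (`frameBasis`);
* §2 increasing symbol lists `frameSymbols t` (`t ⊂ Fin 2n`, `|t| = k`, read through a fixed enumeration of the
  symbols), the frame tuples `frameTuple z t`, and the KRONECKER EVALUATION
  `coordForm (frameSymbols t') z (frameTuple z t) = δ_{t t'}` (`coordForm_apply_frameTuple`);
* §3 the coefficients `formCoeff ω t z = ω_z(frameTuple z t)` and **the expansion
  `ω_z = Σ_t formCoeff ω t z • coordForm (frameSymbols t) z` on `ℍⁿ`** (`eq_sum_formCoeff_smul_coordForm`, from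
  Mathlib's `Module.Basis.ext_multilinear` and the behaviour of alternating maps under permutations), with uniqueness
  (`sum_smul_coordForm_apply_frameTuple`);
* §4 smoothness of the coefficients on `ℍⁿ` and their independence of `x` for `x`-independent `ω`;
* §5 transformation rules: under `γ = (e m; 0 e⁻¹) ∈ Γ_∞` the coefficient of `γ^*ω` is
  `(Π_{inl σ ∈ t} σ(e²)) · formCoeff ω t (γz)` — the CHARACTER of the sector `{σ : dx_σ occurs}` — and under the
  dilations `δ_ℓ : (x, y) ↦ (x, e^ℓ y)` it is `formCoeff ω t (δ_ℓ z)` (no factor: `δ_ℓ^*(dy_σ/y_σ) = dy_σ/y_σ`).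

## References

* [Freitag1990] E. Freitag, *Hilbert Modular Forms*, Springer (1990): Ch. III §2, the forms `dx_a ∧ dy_b/y_b`
  (p. 143), Prop. 2.1 and its proof (pp. 143–145).
* [BottTu1982Forms] R. Bott, L. Tu, *Differential Forms in Algebraic Topology*, GTM 82 (1982), §I.4.
-/

noncomputable section

/- Instance search through the form spaces `Point F [⋀^Fin p]→L[ℝ] ℂ` nests pending instance problems three deep
(see `…HilbertModularInvariantForms`). -/
set_option maxSynthPendingDepth 3

open scoped Matrix MatrixGroups Classical Topology ContDiff

open Set Function Filter Complex ContinuousAlternatingMap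

namespace Literature.NumberTheory.Automorphic.HilbertModular

open _root_.NumberField Module
open Literature.Geometry.Kaehler.ComplexTorus.HilbertModularFamily
open Literature.NumberTheory.Transcendental (ContDiffAt.continuousAlternatingMap_apply_const)

variable {F : Type*} [Field F] [NumberField F] [IsTotallyReal F]

/-! ## §1 The frame vectors dual to `dx_σ`, `dy_σ/y_σ` -/

section Frame

variable (F) in
/-- **The unit vectors `e_σ` and `i e_σ`** of `ℂ^{Hom(F,ℝ)}`, named by the coordinate symbols `inl σ` (`dx_σ`) and
`inr σ` (`dy_σ`). [cite: Freitag1990, Ch. III §2, p. 143] -/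
def unitVec : (F →+* ℝ) ⊕ (F →+* ℝ) → Point F :=
  Sum.elim (fun σ => realToPoint F (Pi.single σ 1)) fun σ => imToPoint F (Pi.single σ 1)

omit [NumberField F] [IsTotallyReal F] in
/-- `(e_σ)_τ = δ_{στ}`. [cite: Freitag1990, Ch. III §2, p. 143] -/
theorem unitVec_inl_apply (σ τ : F →+* ℝ) : unitVec F (Sum.inl σ) τ = if τ = σ then 1 else 0 := by
  simp [unitVec, Pi.single_apply, apply_ite]

omit [NumberField F] [IsTotallyReal F] in
/-- `(i e_σ)_τ = i δ_{στ}`. [cite: Freitag1990, Ch. III §2, p. 143] -/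
theorem unitVec_inr_apply (σ τ : F →+* ℝ) : unitVec F (Sum.inr σ) τ = if τ = σ then I else 0 := by
  simp only [unitVec, Sum.elim_inr, imToPoint_apply, Pi.single_apply]
  split_ifs <;> simp

/-- **Freitag's frame vectors at `z`**: `frameVec z (inl σ) = e_σ` (dual to `dx_σ`) and
`frameVec z (inr σ) = y_σ · i e_σ` (dual to `dy_σ/y_σ`), i.e. `coordWeight z s • unitVec s`.
[cite: Freitag1990, Ch. III §2, p. 143 («`dx_a ∧ dy_b/y_b`»)] -/
def frameVec (z : Point F) (s : (F →+* ℝ) ⊕ (F →+* ℝ)) : Point F :=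
  (coordWeight z s : ℝ) • unitVec F s

omit [NumberField F] [IsTotallyReal F] in
/-- **Duality with the coordinate functionals**: `c_s(unitVec s') = δ_{s s'}`. [cite: Freitag1990, Ch. III §2, p. 143] -/
theorem coordCLM_unitVec (s s' : (F →+* ℝ) ⊕ (F →+* ℝ)) : coordCLM s (unitVec F s') = if s = s' then 1 else 0 := by
  cases s with
  | inl σ =>
    cases s' with
    | inl τ =>
      rw [coordCLM_inl, dxCLM_apply, unitVec_inl_apply]
      by_cases h : σ = τ
      · subst h; simp
      · simp [h]
    | inr τ =>
      rw [coordCLM_inl, dxCLM_apply, unitVec_inr_apply]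
      simp [apply_ite]
  | inr σ =>
    cases s' with
    | inl τ =>
      rw [coordCLM_inr, dyCLM_apply, unitVec_inl_apply]
      simp [apply_ite]
    | inr τ =>
      rw [coordCLM_inr, dyCLM_apply, unitVec_inr_apply]
      by_cases h : σ = τ
      · subst h; simp
      · simp [h]

omit [NumberField F] [IsTotallyReal F] in
/-- **`c_s(frameVec z s') = δ_{s s'} · coordWeight z s`**: the frame is dual to `(dx_σ, dy_σ/y_σ)`.
[cite: Freitag1990, Ch. III §2, p. 143] -/
theorem coordCLM_frameVec (z : Point F) (s s' : (F →+* ℝ) ⊕ (F →+* ℝ)) :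
    coordCLM s (frameVec z s') = if s = s' then coordWeight z s else 0 := by
  rw [frameVec, map_smul, coordCLM_unitVec, smul_eq_mul]
  split_ifs with h
  · subst h; rw [mul_one]
  · rw [mul_zero]

omit [NumberField F] [IsTotallyReal F] in
/-- The frame depends on `z` only through `y = Im z`: it is unchanged by real translations.
[cite: Freitag1990, Ch. III §2, p. 145] -/
theorem frameVec_add_realToPoint (z : Point F) (x : (F →+* ℝ) → ℝ) (s : (F →+* ℝ) ⊕ (F →+* ℝ)) :
    frameVec (z + realToPoint F x) s = frameVec z s := by
  cases s with
  | inl σ => simp [frameVec]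
  | inr σ => simp [frameVec]

omit [IsTotallyReal F] in
/-- Every vector is the combination `v = Σ_s c_s(v) • unitVec s` (`v_τ = Re v_τ + i Im v_τ`).
[cite: Freitag1990, Ch. III §2, p. 143] -/
theorem sum_coordCLM_smul_unitVec (v : Point F) : ∑ s, (coordCLM s v : ℝ) • unitVec F s = v := by
  funext τ
  simp only [Finset.sum_apply, Pi.smul_apply, Fintype.sum_sum_type, coordCLM_inl, coordCLM_inr, dxCLM_apply, dyCLM_apply,
    unitVec_inl_apply, unitVec_inr_apply, smul_ite, smul_zero, Finset.sum_ite_eq, Finset.mem_univ, if_true]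
  rw [Complex.real_smul, Complex.real_smul, mul_one]
  exact Complex.re_add_im (v τ)

/-- **The frame coordinates** of a vector at `z ∈ ℍⁿ`: `v ↦ (c_s(v) / coordWeight z s)_s`, a linear isomorphism
`ℂ^{Hom(F,ℝ)} ≃ ℝ^{2n}` with inverse `a ↦ Σ_s a_s • frameVec z s`. [cite: Freitag1990, Ch. III §2, p. 143] -/
def frameCoords {z : Point F} (hz : z ∈ halfSpace F) : Point F ≃ₗ[ℝ] ((F →+* ℝ) ⊕ (F →+* ℝ) → ℝ) where
  toFun v s := coordCLM s v / coordWeight z s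
  invFun a := ∑ s, a s • frameVec z s
  map_add' v v' := funext fun s => by simp only [map_add, Pi.add_apply]; ring
  map_smul' r v := funext fun s => by simp only [map_smul, smul_eq_mul, Pi.smul_apply, RingHom.id_apply]; ring
  left_inv v := by
    have h : ∀ s, (coordCLM s v / coordWeight z s) • frameVec z s = (coordCLM s v : ℝ) • unitVec F s := fun s => by
      rw [frameVec, smul_smul, div_mul_cancel₀ _ (coordWeight_pos hz s).ne']
    simp only [h]
    exact sum_coordCLM_smul_unitVec v
  right_inv a := funext fun s => by
    simp only [_root_.map_sum, _root_.map_smul, coordCLM_frameVec, smul_eq_mul, mul_ite, mul_zero, Finset.sum_ite_eq,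
      Finset.mem_univ, if_true]
    rw [mul_div_assoc, div_self (coordWeight_pos hz s).ne', mul_one]

/-- **The frame basis** `(frameVec z s)_s` of `ℂ^{Hom(F,ℝ)}` over `ℝ`, for `z ∈ ℍⁿ`. [cite: Freitag1990, Ch. III §2, p. 143] -/
def frameBasis {z : Point F} (hz : z ∈ halfSpace F) : Module.Basis ((F →+* ℝ) ⊕ (F →+* ℝ)) ℝ (Point F) :=
  Module.Basis.ofEquivFun (frameCoords hz)

omit [IsTotallyReal F] in
/-- The frame basis consists of the frame vectors. [cite: Freitag1990, Ch. III §2, p. 143] -/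
@[simp]
theorem frameBasis_apply {z : Point F} (hz : z ∈ halfSpace F) (s : (F →+* ℝ) ⊕ (F →+* ℝ)) :
    frameBasis hz s = frameVec z s := by
  rw [frameBasis, Module.Basis.coe_ofEquivFun]
  show (∑ s', (Pi.single s (1 : ℝ) : _ → ℝ) s' • frameVec z s') = frameVec z s
  simp [Pi.single_apply]

end Frame

/-! ## §2 Increasing symbol lists, frame tuples, and the Kronecker evaluation -/

section Tuples

variable (F) in
/-- A fixed enumeration of the `2n` coordinate symbols. [cite: Freitag1990, Ch. III §2, p. 143] -/
def symbEquiv : Fin (Fintype.card ((F →+* ℝ) ⊕ (F →+* ℝ))) ≃ ((F →+* ℝ) ⊕ (F →+* ℝ)) :=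
  (Fintype.equivFin _).symm

variable (F) in
/-- **The index set of the frame of `k`-forms**: subsets `t ⊂ Fin 2n` with `|t| = k` (the increasing multi-indices
`a_1 < ⋯ < a_q`, `b_1 < ⋯ < b_p`, `p + q = k`, in one enumeration). [cite: Freitag1990, Ch. III §2, p. 143] -/
abbrev FrameIdx (k : ℕ) : Type := {t : Finset (Fin (Fintype.card ((F →+* ℝ) ⊕ (F →+* ℝ)))) // t.card = k}

/-- The increasing list of symbols of an index `t`. [cite: Freitag1990, Ch. III §2, p. 143] -/
def frameSymbols {k : ℕ} (t : FrameIdx F k) : Fin k → (F →+* ℝ) ⊕ (F →+* ℝ) := fun i =>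
  symbEquiv F (t.1.orderEmbOfFin t.2 i)

omit [IsTotallyReal F] in
/-- The symbol list of `t` is injective. [cite: Freitag1990, Ch. III §2, p. 143] -/
theorem frameSymbols_injective {k : ℕ} (t : FrameIdx F k) : Function.Injective (frameSymbols t) :=
  (symbEquiv F).injective.comp (t.1.orderEmbOfFin t.2).injective

omit [IsTotallyReal F] in
/-- `s` occurs in the list of `t` iff its number lies in `t`. [cite: Freitag1990, Ch. III §2, p. 143] -/
theorem mem_range_frameSymbols_iff {k : ℕ} (t : FrameIdx F k) (s : (F →+* ℝ) ⊕ (F →+* ℝ)) :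
    s ∈ Set.range (frameSymbols t) ↔ (symbEquiv F).symm s ∈ t.1 := by
  constructor
  · rintro ⟨i, rfl⟩
    rw [frameSymbols, Equiv.symm_apply_apply]
    exact Finset.orderEmbOfFin_mem _ _ _
  · intro h
    have h' : (symbEquiv F).symm s ∈ Set.range (t.1.orderEmbOfFin t.2) := by
      rw [Finset.range_orderEmbOfFin]; exact h
    obtain ⟨i, hi⟩ := h'
    exact ⟨i, by rw [frameSymbols, hi, Equiv.apply_symm_apply]⟩

omit [IsTotallyReal F] in
/-- Distinct indices have a symbol of the first missing from the second. [cite: Freitag1990, Ch. III §2, p. 143] -/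
theorem exists_frameSymbols_not_mem_range {k : ℕ} {t t' : FrameIdx F k} (h : t ≠ t') :
    ∃ i, frameSymbols t i ∉ Set.range (frameSymbols t') := by
  by_contra hcon
  have hcon' : ∀ i, frameSymbols t i ∈ Set.range (frameSymbols t') := fun i => by_contra fun hi => hcon ⟨i, hi⟩
  apply h
  have hsub : t.1 ⊆ t'.1 := fun x hx => by
    have hx' : symbEquiv F x ∈ Set.range (frameSymbols t) :=
      (mem_range_frameSymbols_iff t _).2 (by rwa [Equiv.symm_apply_apply])
    obtain ⟨i, hi⟩ := hx'
    have := hcon' i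
    rw [hi, mem_range_frameSymbols_iff, Equiv.symm_apply_apply] at this
    exact this
  exact Subtype.ext (Finset.eq_of_subset_of_card_le hsub (by rw [t.2, t'.2]))

/-- **The frame tuple of `t` at `z`**: `(frameVec z (c_1), …, frameVec z (c_k))` for the symbol list `c` of `t`.
[cite: Freitag1990, Ch. III §2, p. 143] -/
def frameTuple {k : ℕ} (z : Point F) (t : FrameIdx F k) : Fin k → Point F := fun i => frameVec z (frameSymbols t i)

omit [IsTotallyReal F] in
/-- The frame tuple is unchanged by real translations. [cite: Freitag1990, Ch. III §2, p. 145] -/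
theorem frameTuple_add_realToPoint {k : ℕ} (z : Point F) (x : (F →+* ℝ) → ℝ) (t : FrameIdx F k) :
    frameTuple (z + realToPoint F x) t = frameTuple z t :=
  funext fun _ => frameVec_add_realToPoint z x _

omit [IsTotallyReal F] in
/-- **Kronecker evaluation**: `(c'_1 ∧ ⋯ ∧ c'_k)(z)(frameTuple z t) = δ_{t t'}` for `z ∈ ℍⁿ` — the frame tuples are
dual to Freitag's forms. [cite: Freitag1990, Ch. III §2, p. 143] -/
theorem coordForm_apply_frameTuple {k : ℕ} {z : Point F} (hz : z ∈ halfSpace F) (t t' : FrameIdx F k) :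
    coordForm (frameSymbols t') z (frameTuple z t) = if t = t' then 1 else 0 := by
  rw [coordForm_apply_of_mem _ hz]
  have hM : (Matrix.of fun i j => coordCLM (frameSymbols t' j) (frameTuple z t i)) =
      Matrix.of fun i j => if frameSymbols t' j = frameSymbols t i then coordWeight z (frameSymbols t' j) else 0 := by
    ext i j
    simp only [Matrix.of_apply, frameTuple, coordCLM_frameVec]
  rw [hM]
  by_cases htt : t = t'
  · subst htt
    rw [if_pos rfl]
    have hD : (Matrix.of fun i j => if frameSymbols t j = frameSymbols t i then coordWeight z (frameSymbols t j) else 0) =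
        Matrix.diagonal fun i => coordWeight z (frameSymbols t i) := by
      ext i j
      simp only [Matrix.of_apply, Matrix.diagonal_apply, (frameSymbols_injective t).eq_iff]
      by_cases hij : i = j
      · subst hij; simp
      · rw [if_neg (Ne.symm hij), if_neg hij]
    rw [hD, Matrix.det_diagonal, Complex.real_smul, Complex.ofReal_inv,
      inv_mul_cancel₀ (by exact_mod_cast (Finset.prod_pos fun i _ => coordWeight_pos hz (frameSymbols t i)).ne')]
  · rw [if_neg htt]
    obtain ⟨i₀, hi₀⟩ := exists_frameSymbols_not_mem_range htt
    rw [Matrix.det_eq_zero_of_row_eq_zero i₀ fun j => ?_, Complex.ofReal_zero, smul_zero]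
    rw [Matrix.of_apply, if_neg]
    exact fun h => hi₀ ⟨j, h⟩

end Tuples

/-! ## §3 Coefficients and the expansion in Freitag's frame -/

section Expansion

variable {k : ℕ}

/-- **The coefficient of `ω` along the index `t` at `z`**: `f_t(z) = ω_z(frameTuple z t)` (Freitag's `f_{ab}(z)` in
`ω = Σ f_{ab} dx_a ∧ dy_b/y_b`). [cite: Freitag1990, Ch. III §2, p. 145] -/
def formCoeff (α : Form F k) (t : FrameIdx F k) (z : Point F) : ℂ :=
  α z (frameTuple z t)

omit [IsTotallyReal F] in
/-- `formCoeff ω t z = ω z (frameTuple z t)`. [cite: Freitag1990, Ch. III §2, p. 145] -/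
theorem formCoeff_apply (α : Form F k) (t : FrameIdx F k) (z : Point F) : formCoeff α t z = α z (frameTuple z t) :=
  rfl

omit [IsTotallyReal F] in
/-- **Uniqueness of coefficients**: evaluating `Σ_t a_t • (c_t-form)` on the frame tuple of `t₀` returns `a_{t₀}`
(`z ∈ ℍⁿ`). [cite: Freitag1990, Ch. III §2, p. 145] -/
theorem sum_smul_coordForm_apply_frameTuple {z : Point F} (hz : z ∈ halfSpace F) (a : FrameIdx F k → ℂ)
    (t₀ : FrameIdx F k) : (∑ t, a t • coordForm (frameSymbols t) z) (frameTuple z t₀) = a t₀ := by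
  simp only [ContinuousAlternatingMap.sum_apply, ContinuousAlternatingMap.smul_apply, coordForm_apply_frameTuple hz,
    smul_eq_mul, mul_ite, mul_one, mul_zero, Finset.sum_ite_eq, Finset.mem_univ, if_true]

omit [IsTotallyReal F] in
/-- An injective tuple of symbols is an increasing list up to a permutation: `J = frameSymbols t ∘ σ`.
[cite: Freitag1990, Ch. III §2, p. 143] -/
theorem exists_eq_frameSymbols_comp_perm {J : Fin k → (F →+* ℝ) ⊕ (F →+* ℝ)} (hJ : Function.Injective J) :
    ∃ (t : FrameIdx F k) (σ : Equiv.Perm (Fin k)), J = frameSymbols t ∘ σ := by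
  set g : Fin k → Fin (Fintype.card ((F →+* ℝ) ⊕ (F →+* ℝ))) := fun i => (symbEquiv F).symm (J i) with hg_def
  have hg : Function.Injective g := (symbEquiv F).symm.injective.comp hJ
  set t₀ : Finset (Fin (Fintype.card ((F →+* ℝ) ⊕ (F →+* ℝ)))) := Finset.univ.image g with ht₀_def
  have ht₀ : t₀.card = k := by
    rw [ht₀_def, Finset.card_image_of_injective _ hg, Finset.card_univ, Fintype.card_fin]
  have hmem : ∀ i, g i ∈ t₀ := fun i => Finset.mem_image_of_mem g (Finset.mem_univ i)
  set τ : Fin k → Fin k := fun i => (t₀.orderIsoOfFin ht₀).symm ⟨g i, hmem i⟩ with hτ_def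
  have hτ : Function.Injective τ := fun i j hij => by
    have h1 := congrArg (t₀.orderIsoOfFin ht₀) hij
    simp only [hτ_def, OrderIso.apply_symm_apply, Subtype.mk.injEq] at h1
    exact hg h1
  refine ⟨⟨t₀, ht₀⟩, Equiv.ofBijective τ (Finite.injective_iff_bijective.mp hτ), funext fun i => ?_⟩
  simp only [Function.comp_apply, Equiv.ofBijective_apply, frameSymbols]
  rw [← Finset.coe_orderIsoOfFin_apply, hτ_def, OrderIso.apply_symm_apply, Equiv.apply_symm_apply]

omit [IsTotallyReal F] in
/-- Alternating maps transform under permutations of the frame tuple by the sign. [cite: BottTu1982Forms, §I.4] -/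
theorem apply_frameTuple_comp_perm (φ : Point F [⋀^Fin k]→L[ℝ] ℂ) (z : Point F) (t : FrameIdx F k)
    (σ : Equiv.Perm (Fin k)) : φ (frameTuple z t ∘ σ) = Equiv.Perm.sign σ • φ (frameTuple z t) := by
  have h := φ.toAlternatingMap.map_perm (frameTuple z t) σ
  simpa using h

omit [IsTotallyReal F] in
/-- **THE EXPANSION IN FREITAG'S FRAME**: for `z ∈ ℍⁿ` every `k`-covector is
`φ = Σ_t φ(frameTuple z t) • (c_t-form at z)`. [cite: Freitag1990, Ch. III §2, p. 145 («`ω = Σ f_{ab} dx_a ∧ dy_b/y_b`»)] -/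
theorem eq_sum_apply_frameTuple_smul_coordForm {z : Point F} (hz : z ∈ halfSpace F) (φ : Point F [⋀^Fin k]→L[ℝ] ℂ) :
    φ = ∑ t : FrameIdx F k, φ (frameTuple z t) • coordForm (frameSymbols t) z := by
  apply ContinuousAlternatingMap.toContinuousMultilinearMap_injective
  apply ContinuousMultilinearMap.toMultilinearMap_injective
  refine Module.Basis.ext_multilinear (fun _ => frameBasis hz) fun J => ?_
  change φ (fun i => frameBasis hz (J i)) =
    (∑ t : FrameIdx F k, φ (frameTuple z t) • coordForm (frameSymbols t) z) (fun i => frameBasis hz (J i))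
  simp only [frameBasis_apply]
  by_cases hJ : Function.Injective J
  · obtain ⟨t₀, σ, rfl⟩ := exists_eq_frameSymbols_comp_perm hJ
    have hv : (fun i => frameVec z ((frameSymbols t₀ ∘ σ) i)) = frameTuple z t₀ ∘ σ := rfl
    rw [hv, apply_frameTuple_comp_perm, apply_frameTuple_comp_perm, sum_smul_coordForm_apply_frameTuple hz]
  · have hv : ¬ Function.Injective (fun i => frameVec z (J i)) := fun h => hJ fun a b hab =>
      h (show frameVec z (J a) = frameVec z (J b) by rw [hab])
    rw [ContinuousAlternatingMap.map_eq_zero_of_not_injective _ _ hv,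
      ContinuousAlternatingMap.map_eq_zero_of_not_injective _ _ hv]

omit [IsTotallyReal F] in
/-- **`ω = Σ_t f_t • (c_t-form)` on `ℍⁿ`** with `f_t = formCoeff ω t`. [cite: Freitag1990, Ch. III §2, p. 145] -/
theorem eq_sum_formCoeff_smul_coordForm (α : Form F k) {z : Point F} (hz : z ∈ halfSpace F) :
    α z = ∑ t : FrameIdx F k, formCoeff α t z • coordForm (frameSymbols t) z :=
  eq_sum_apply_frameTuple_smul_coordForm hz (α z)

omit [IsTotallyReal F] in
/-- The coefficients of a frame combination are its coefficient functions (`z ∈ ℍⁿ`). [cite: Freitag1990, Ch. III §2, p. 145] -/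
theorem formCoeff_sum_smul_coordForm (a : FrameIdx F k → Point F → ℂ) {z : Point F} (hz : z ∈ halfSpace F)
    (t₀ : FrameIdx F k) :
    formCoeff (fun w => ∑ t, a t w • coordForm (frameSymbols t) w) t₀ z = a t₀ z :=
  sum_smul_coordForm_apply_frameTuple hz (fun t => a t z) t₀

omit [IsTotallyReal F] in
/-- Two covectors with the same frame coefficients at `z ∈ ℍⁿ` are equal. [cite: Freitag1990, Ch. III §2, p. 145] -/
theorem eq_of_apply_frameTuple_eq {z : Point F} (hz : z ∈ halfSpace F) {φ ψ : Point F [⋀^Fin k]→L[ℝ] ℂ}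
    (h : ∀ t : FrameIdx F k, φ (frameTuple z t) = ψ (frameTuple z t)) : φ = ψ := by
  rw [eq_sum_apply_frameTuple_smul_coordForm hz φ, eq_sum_apply_frameTuple_smul_coordForm hz ψ]
  simp only [h]

end Expansion

/-! ## §4 Smoothness of the coefficients; `x`-independence -/

section Smooth

variable {k : ℕ}

omit [IsTotallyReal F] in
/-- `f_t(z) = (Π_i coordWeight z (c_i)) · ω_z(unit tuple)`: the `z`-dependence of the frame is a polynomial weight.
[cite: Freitag1990, Ch. III §2, p. 145] -/
theorem formCoeff_eq_prod_smul (α : Form F k) (t : FrameIdx F k) (z : Point F) :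
    formCoeff α t z = (∏ i, coordWeight z (frameSymbols t i)) • α z (fun i => unitVec F (frameSymbols t i)) := by
  rw [formCoeff_apply]
  exact (α z).map_smul_univ (fun i => coordWeight z (frameSymbols t i)) fun i => unitVec F (frameSymbols t i)

omit [IsTotallyReal F] in
/-- **The coefficients of a smooth form are smooth on `ℍⁿ`.** [cite: Freitag1990, Ch. III §2, p. 145] -/
theorem contDiffOn_formCoeff {α : Form F k} (hα : ContDiffOn ℝ ∞ α (halfSpace F)) (t : FrameIdx F k) :
    ContDiffOn ℝ ∞ (formCoeff α t) (halfSpace F) := by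
  have h1 : ContDiff ℝ ∞ fun z : Point F => ∏ i, coordWeight z (frameSymbols t i) :=
    contDiff_prod fun i _ => contDiff_coordWeight (frameSymbols t i)
  have h2 : ContDiffOn ℝ ∞ (fun z => α z (fun i => unitVec F (frameSymbols t i))) (halfSpace F) := fun z hz =>
    ((hα.contDiffAt (isOpen_halfSpace.mem_nhds hz)).continuousAlternatingMap_apply_const _).contDiffWithinAt
  have h := h1.contDiffOn.smul h2
  refine h.congr fun z _ => ?_
  exact formCoeff_eq_prod_smul α t z

omit [IsTotallyReal F] in
/-- **For an `x`-independent form the coefficients are `x`-independent.** [cite: Freitag1990, Ch. III §2, p. 145] -/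
theorem formCoeff_add_realToPoint {α : Form F k} (hα : ∀ z x, α (z + realToPoint F x) = α z) (t : FrameIdx F k)
    (z : Point F) (x : (F →+* ℝ) → ℝ) : formCoeff α t (z + realToPoint F x) = formCoeff α t z := by
  rw [formCoeff_apply, formCoeff_apply, hα, frameTuple_add_realToPoint]

end Smooth

/-! ## §5 Transformation of the coefficients under `Γ_∞` and under dilations -/

section Transform

variable {k : ℕ}

/-- **The sector character factor of a symbol** under `z ↦ εz + b`: `σ(ε)` for `dx_σ`, `1` for `dy_σ/y_σ`.
[cite: Freitag1990, Ch. III §2, p. 145] -/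
def charFactor (ε : F) : (F →+* ℝ) ⊕ (F →+* ℝ) → ℝ :=
  Sum.elim (fun σ => σ ε) fun _ => 1

omit [NumberField F] [IsTotallyReal F] in
/-- `charFactor ε (inl σ) = σ ε`. [cite: Freitag1990, Ch. III §2, p. 145] -/
@[simp] theorem charFactor_inl (ε : F) (σ : F →+* ℝ) : charFactor ε (Sum.inl σ) = σ ε := rfl

omit [NumberField F] [IsTotallyReal F] in
/-- `charFactor ε (inr σ) = 1`. [cite: Freitag1990, Ch. III §2, p. 145] -/
@[simp] theorem charFactor_inr (ε : F) (σ : F →+* ℝ) : charFactor ε (Sum.inr σ) = 1 := rfl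

omit [NumberField F] [IsTotallyReal F] in
/-- **The scaling `D_ε` on the frame**: `D_ε (frameVec z s) = charFactor ε s • frameVec (D_ε z + b) s` for real `b`
(`D_ε e_σ = σ(ε) e_σ`, while `D_ε (y_σ i e_σ) = (σ(ε) y_σ) i e_σ` is the frame vector at the image point).
[cite: Freitag1990, Ch. III §2, p. 145] -/
theorem scalePoint_frameVec (ε : F) (z : Point F) (x : (F →+* ℝ) → ℝ) (s : (F →+* ℝ) ⊕ (F →+* ℝ)) :
    scalePoint F ε (frameVec z s) = (charFactor ε s : ℝ) • frameVec (scalePoint F ε z + realToPoint F x) s := by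
  funext τ
  cases s with
  | inl σ =>
    simp only [frameVec, coordWeight_inl, one_smul, scalePoint_apply, unitVec_inl_apply, charFactor_inl, Pi.smul_apply]
    split_ifs with h
    · subst h; simp
    · simp
  | inr σ =>
    simp only [frameVec, coordWeight_inr, scalePoint_apply, Pi.smul_apply, unitVec_inr_apply, charFactor_inr, one_smul,
      Pi.add_apply, realToPoint_apply, Complex.add_im, Complex.ofReal_im, add_zero, Complex.mul_im, Complex.ofReal_re,
      Complex.ofReal_im, zero_mul]
    split_ifs with h
    · subst h
      simp only [Complex.real_smul]
      push_cast
      ring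
    · simp

omit [IsTotallyReal F] in
/-- `D_ε` on a frame tuple. [cite: Freitag1990, Ch. III §2, p. 145] -/
theorem scalePoint_comp_frameTuple (ε : F) (z : Point F) (x : (F →+* ℝ) → ℝ) (t : FrameIdx F k) :
    (fun i => scalePoint F ε (frameTuple z t i)) =
      fun i => (charFactor ε (frameSymbols t i) : ℝ) • frameTuple (scalePoint F ε z + realToPoint F x) t i :=
  funext fun _ => scalePoint_frameVec ε z x _

omit [IsTotallyReal F] in
/-- **The coefficients of `γ^*ω` for `γ = (e m; 0 e⁻¹)`**:
`formCoeff (γ^*ω) t z = (Π_i charFactor (e²) (c_i)) · formCoeff ω t (γz)` — the product `Π_{inl σ ∈ t} σ(e²)` is the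
CHARACTER of the sector of `t`. [cite: Freitag1990, Ch. III §2, p. 145 («invariant under `z ↦ εz + b`»)] -/
theorem formCoeff_moebPullback_upperTri (α : Form F k) (e : Fˣ) (m : F) (t : FrameIdx F k) (z : Point F) :
    formCoeff (moebPullback (upperTri e m) α) t z =
      (∏ i, charFactor ((e ^ 2 : Fˣ) : F) (frameSymbols t i)) • formCoeff α t (moeb (upperTri e m) z) := by
  rw [formCoeff_apply, moebPullback_def, fderiv_moeb_upperTri, ContinuousAlternatingMap.compContinuousLinearMap_apply,
    formCoeff_apply]
  have h : (⇑(scalePoint F ((e ^ 2 : Fˣ) : F)) ∘ frameTuple z t) =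
      fun i => (charFactor ((e ^ 2 : Fˣ) : F) (frameSymbols t i) : ℝ) • frameTuple (moeb (upperTri e m) z) t i := by
    rw [show moeb (upperTri e m) z = scalePoint F ((e ^ 2 : Fˣ) : F) z + realToPoint F (embVec ((e : F) * m)) from
      moeb_upperTri_eq e m z]
    exact scalePoint_comp_frameTuple _ z _ t
  rw [h]
  exact (α _).map_smul_univ _ _

omit [IsTotallyReal F] in
/-- **The dilation `δ_ℓ` maps the frame at `z` to the frame at `δ_ℓ z`**: `δ_ℓ e_σ = e_σ`,
`δ_ℓ (y_σ i e_σ) = (e^{ℓ_σ} y_σ) i e_σ`. [cite: Freitag1990, Ch. III §2, p. 144] -/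
theorem dilateL_frameVec (ℓ : (F →+* ℝ) → ℝ) (z : Point F) (s : (F →+* ℝ) ⊕ (F →+* ℝ)) :
    dilateL ℓ (frameVec z s) = frameVec (dilateL ℓ z) s := by
  funext τ
  cases s with
  | inl σ =>
    rw [dilateL_apply]
    simp only [frameVec, coordWeight_inl, one_smul, unitVec_inl_apply]
    split_ifs <;> simp
  | inr σ =>
    rw [dilateL_apply]
    simp only [frameVec, coordWeight_inr, Pi.smul_apply, unitVec_inr_apply, dilateL_apply_im]
    split_ifs with h
    · subst h
      simp only [Complex.real_smul, Complex.mul_re, Complex.ofReal_re, Complex.ofReal_im, Complex.I_re, Complex.I_im,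
        mul_zero, sub_zero, Complex.mul_im, mul_one, add_zero, Complex.ofReal_zero, zero_add]
    · simp

omit [IsTotallyReal F] in
/-- **The coefficients of `δ_ℓ^*ω`**: `formCoeff (δ_ℓ^*ω) t z = formCoeff ω t (δ_ℓ z)` for `z ∈ ℍⁿ` (no factor:
`δ_ℓ^* dx_σ = dx_σ`, `δ_ℓ^*(dy_σ/y_σ) = dy_σ/y_σ`). [cite: Freitag1990, Ch. III §2, p. 144] -/
theorem formCoeff_dilPullback (α : Form F k) (ℓ : (F →+* ℝ) → ℝ) (t : FrameIdx F k) {z : Point F}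
    (hz : z ∈ halfSpace F) : formCoeff (dilPullback ℓ α) t z = formCoeff α t (dilateL ℓ z) := by
  rw [formCoeff_apply, dilPullback_of_mem ℓ α hz, ContinuousAlternatingMap.compContinuousLinearMap_apply, formCoeff_apply]
  congr 1
  funext i
  exact dilateL_frameVec ℓ z _

end Transform

end Literature.NumberTheory.Automorphic.HilbertModular
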